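import Summits.BirchSwinnertonDyer.Rank1Residual.ManinAdditive.ShimuraFiveResidual
import Summits.BirchSwinnertonDyer.BirchSwinnertonDyer.Theorems.ManinLocalTwoThreeShimuraIndexBadPrimeSieve
import HarnessLib

/-!
# E-es-226/229/230 are theorems; E-es-224 ⟸ E-es-227 ∧ E-es-228 unconditionally (cell bsd-f2-manin, es g43 ROAD γ; MEMO-es §66)

Closes the cell rows E-es-226 `EsG43.ShimuraFiveLevelProfile`, E-es-229 `EsG43.ShimuraFiveSquarefreeLevelProfile`, E-es-230
`EsG43.ShimuraFiveLevelCoprimeFortyTwo` BY NAME from `Theorems/ManinLocalTwoThreeShimuraIndexBadPrimeSieve.lean` (`ShimuraSieve.level_profile_five_datum`,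
`…level_profile_five_of_squarefree'`, `…level_coprime_fortytwo`) and records the unconditional decomposition of the OPEN row E-es-224 `EsG43.ShimuraFiveOnlyAtEleven` into
E-es-227 `ShimuraFiveNoTwentyFive` (beyond print) and E-es-228 `ShimuraFiveSquarefreeOnlyAtEleven` (Byeon–Kim's printed range).  E-es-224/227/228, C2,
C3, Manin's conjecture and BSD are NOT proved by this file; standard axioms only.
[cite: LingOesterle1991, Thm. 6] [cite: AtkinLehner1970, Thm. 3] [cite: ByeonKim2014, Thm. 1.1 and Prop. 4.1]
-/

set_option autoImplicit false
-- lint-debt: the directory name repeats the summit name (sibling precedent `ManinLocalTwoThreeShimuraFiveElevenHolds.lean`)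
set_option linter.dupNamespace false

noncomputable section

open scoped MatrixGroups ModularForm

open CongruenceSubgroup Complex WeierstrassCurve Literature.NumberTheory.EllipticCurves
  Literature.NumberTheory.EllipticCurves.ModularForms
open Summit.BirchSwinnertonDyer.Rank1Residual.ManinAdditive Summit.BirchSwinnertonDyer.Rank1Residual.ManinAdditive.KatoCurve
open Summit.BirchSwinnertonDyer.Rank1Residual.ManinAdditive.EsG43
open Summit.BirchSwinnertonDyer.BirchSwinnertonDyer.Theorems.ManinLocalTwoThree

namespace Summit.BirchSwinnertonDyer.BirchSwinnertonDyer.Theorems.ManinLocalTwoThree.ShimuraFiveResidual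

/-- **E-es-226 `ShimuraFiveLevelProfile` IS A THEOREM** (the bad-prime sieve + THEOREM AL + ROAD β). -/
theorem shimuraFiveLevelProfile_holds : ShimuraFiveLevelProfile :=
  fun W₀ _ _ _ _ D₀ hopt hS _ hp hpN ↦ ShimuraSieve.level_profile_five_datum W₀ D₀ hopt hS hp hpN

/-- **E-es-229 `ShimuraFiveSquarefreeLevelProfile` IS A THEOREM** (hopt-free, squarefree level). -/
theorem shimuraFiveSquarefreeLevelProfile_holds : ShimuraFiveSquarefreeLevelProfile :=
  fun W _ _ _ _ D hsq hS _ hp hpN ↦ ShimuraSieve.level_profile_five_of_squarefree' W D hsq hS hp hpN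

/-- **E-es-230 `ShimuraFiveLevelCoprimeFortyTwo` IS A THEOREM** (any newform). -/
theorem shimuraFiveLevelCoprimeFortyTwo_holds : ShimuraFiveLevelCoprimeFortyTwo :=
  fun _ hf hS ↦ ShimuraSieve.level_coprime_fortytwo hf hS

/-- **E-es-224 ⟸ E-es-227 ∧ E-es-228, unconditionally** (the converses are in the node file): «a `5` in the Shimura-cover kernel only at `N = 11`»
is exactly «never `25 ∣ N`» together with Byeon–Kim's squarefree case. [cite: ByeonKim2014, Thm. 1.1] -/
theorem shimuraFiveOnlyAtEleven_of_residuals (h25 : ShimuraFiveNoTwentyFive) (hsq : ShimuraFiveSquarefreeOnlyAtEleven) :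
    ShimuraFiveOnlyAtEleven :=
  shimuraFiveOnlyAtEleven_of_levelProfile shimuraFiveLevelProfile_holds h25 hsq

end Summit.BirchSwinnertonDyer.BirchSwinnertonDyer.Theorems.ManinLocalTwoThree.ShimuraFiveResidual

end
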